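import Summits.QuantumFields.BalabanUV.T4Continuum.Support.NE9MarginalFreeClass
import Summits.QuantumFields.BalabanUV.T4Continuum.Support.NE9FadingArithmeticRider

/-!
# NE4ReadOutSocketMarginalFree — node U2's MOST-REDUCED probe-recipe face on row NE9's marginal-projection END: the last
# projection binder `ProjInto` DISCHARGED BY NAME, and the NORMALISATION FLOOR inside the discrete-Grönwall memory gap
# (cell `pub-balaban`, T⁴-continuum fan-out, `HOME/BINDER-OWNERS.md` row NE4, owner lineage t4-ne4-p1, generation 36;
# technique lane P1 = discrete Grönwall / fading memory; v1.1 = v1 + §4, same generation)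

HONEST FRAMING (T4-DAG PAGE 1).  Rung (B)+1 on a FIXED finite torus T⁴ — NOT infinite volume, NOT a mass gap, NOT the Clay
problem.  NE4 (node U2) is DEPENDENT = (R)∘{NE5, NE9}; NE5, NE9 are the cell's own estimates, NOT PRINTED, NOT PROVED; spine
estimates proved 0/9, unchanged by this module.  [I] = [Balaban1987RG1] is quoted for TYPES/STRUCTURE only (ABSOLUTE RULE):
a locator says which printed sentence a hypothesis SHAPE types, nothing of [I] is asserted.  `FlowStep.BetaPertH`, (B), (B^μ)
do not occur (they live in the window `W` / the runs of whoever instantiates).  HONEST DEPENDENCY (cell, verbatim): continuum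
YM on T⁴ ⇐ BetaPertH ∧ nine spine estimates (0/9 proved); BetaPertH ⇐ (D1) ∧ (D4) ∧ CAP+tail; G-an2-4 gates asym, D1 and
NE2/3/4.

WHAT THIS MODULE IS.  Generation 35 (`Support/NE4ReadOutSocketMarginalRecipe`, §3 `ne4_of_margNE9_NE5_recipe`) put node U2's
TRIPLE on row NE9's marginal-projection END with the projection read by node U2's own probe recipe
(`P := margProj (shiftRead PB.transportTo.recipe) A`, `T4BetaReadOutLipschitz.Probes`) and NO read-out binder left; of the
four projection binders three were kernel (`projBinders_recipe`) and ONE stayed displayed: `hPinto : ProjInto Adm MF P` (the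
projected admissible families are marginal-free — the recipe NORMALISED against the marginal direction `A`).  Row NE9's
swarm leaf MP (`Support/NE9MarginalFreeClass`, unit t4-ne9-formalise-leaf-04-g3, p210502) then proved `projInto_recipe`:
for probe recipes `ProjInto` follows from ONE displayed number per read step, `Pr.recipe k A = 1` ([I] p. 258 «We define
the function β_j(g_{j−1}) to be equal to the coefficient β» of βA^η; (1.20)–(1.22) p. 264 — TYPE), an analytic marginal
direction, and a structural class `S` containing the projections, at the marginal-free class written INLINE
`{H | H ∈ Pr.Analytic α ∧ H ∈ S ∧ ∀ k, Pr.recipe k H = 0}`.  This module closes that junction FROM NODE U2's SIDE and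
records what the normalisation costs in this lane's scalar (the memory gap of the discrete-Grönwall closure):

* §0 CLASS BOOKKEEPING.  The three channel binders of row NE9's frame (`ChannelAdditive`, `ChannelStepSum`,
  `ChannelSizeAtStepNN` of `T4HistoryLipschitzRecursion`) are ANTITONE in the class: a consumer holding them on a larger
  marginal-free class restricts them to the inline class of §2 (`channelAdditive_anti`, `channelStepSum_anti`,
  `channelSizeAtStepNN_anti`).
* §1 THE NORMALISATION FLOOR AT NODE U2.  For a probe recipe (chart radius `α`, locality sum `K`, read-out constant
  `cr = 8K/α²`) normalised at ONE step against an analytic marginal direction of size `aA` (`DirSize A κ aA`):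
  `1 ≤ (8K/α²)·aA` (`one_le_readConst_mul_dirSize_recipe` — row NE9's (w10) floor
  `NE9FadingArithmeticRider.one_le_readConst_mul_dirSize` fed BY NAME with `readSize_recipe`, `restrictScale_mem_analytic`,
  `recipe_restrictScale`).  Hence the memory rate of the marginal face, `ν = ω + 8·lipbar·B·((1 + (8K/α²)·aA)·τ̄)`, obeys
  `ω + 16·lipbar·B·τ̄ ≤ ν` (`memoryRate_floor`, `memoryRate_floor_recipe`), and the memory GAP `ν < ρ` under which
  `T4CurrencyMatching.injectedRate_of_runs_gap` closes the two-sided matching recursion REQUIRES the node-U2-constant-free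
  smallness `ω + 16·lipbar·B·τ̄ < ρ` (`memoryGap_necessary`, `memoryGap_necessary_recipe`): re-attaching the (1.3) p. 260
  counterterm through node U2's own read-out at least DOUBLES the feedback gain `8·lipbar·B·τ̄` of row NE9's recursion.
  (NECESSARY, not sufficient; the sufficient form stays `NE4ReadOutSocketMarginal.memoryGap_of_smallness`.)
* §2 `ne4_of_margNE9_NE5_recipe_free` — generation 35's `ne4_of_margNE9_NE5_recipe` with `hPinto` DISCHARGED by
  `projInto_recipe` at `MF := {H | H ∈ PB.transportTo.Analytic α ∧ H ∈ S ∧ ∀ k, PB.transportTo.recipe k H = 0}`; displayed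
  instead: `hAan : A ∈ PB.transportTo.Analytic α` (TYPE (1.17) p. 263 for the one-cube Wilson action), `hS` (the projections
  lie in the structural class `S` — O1 data), `hnorm : ∀ k, PB.transportTo.recipe k A = 1` (the one number per read step).
  With it ALL FOUR projection binders and ALL THREE read-out binders of row NE9's marginal-projection END are kernel at node
  U2 for probe recipes; the channel binders `hadd`/`hsum`/`hstep` are stated ON the inline class.
* §3 `injectedRate_of_margNE9_NE5_recipe_free` — node U2's OUTPUT in the spine's currency,
  `T4CauchySum.InjectedRate (2·((8K/α²)·C₅·θ₅)/(1 − ρ)) 0 ρ (disc of the runs of (0.20))`, by the GAP route on §2 (binder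
  `hinj` of `T4TowerRateDischarge.uRateUpTo_of_nodes`); the gap `hνρ : ν < ρ` is displayed and, by §1, forces
  `ω + 16·lipbar·B·τ̄ < ρ` (`memoryGap_necessary_of_face`).
* §4 (v1.1) NON-VACUITY OF THE SCALARS WITH THE FLOOR AT EQUALITY: one rational point satisfying AT ONCE the floor
  `(8K/α²)·aA = 1`, the sign `hpos`, the gap `ν < ρ`, the rates, the window `hsmall` of §3, the necessary line of §1 and the
  sufficient line of `NE4ReadOutSocketMarginal.memoryGap_of_smallness` (`ω = 1/4`, `ρ = θ₅ = 1/2`, `lipbar = B = 1`, `τ̄ = 1/128`,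
  `K = 1`, `α = 2`, `aA = 1/2`, `ℓ = 1/64`, `γ = 1/2`, `ν = 3/8`); and a point with `ω < ρ` where the necessary line FAILS
  (`τ̄ = 1/60`: `1/4 + 16/60 > 1/2`) — the factor 2 bites.  Toy numbers are witnesses, never statement inputs.

WHAT STAYS OPEN after this (no row owns it; unchanged): the (1.20) probe configurations of [I] as a `Probes` DATUM and
Bałaban's 𝐄^{(j)} as the `Functional` it reads (instantiation layer O1) — now INCLUDING the two O1 readings `hnorm` (the datum
reads 1 on A^η) and `hS`; rows NE5/NE9 themselves.

WHAT IS PROVED: bookkeeping BY NAME (compositions of landed theorems), three one-line antitonicity facts, one `nlinarith` sign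
computation, and (§4, v1.1) two decided numerical examples.  0 sorry; axioms ⊆ {propext, Classical.choice, Quot.sound}; imports the LANDED modules
`Support/NE9MarginalFreeClass` (p210502) and `Support/NE9FadingArithmeticRider` and modifies nothing of them; no END face of
row NE9 is re-wired.  Rung (B)+1 finite T⁴; NOT summit progress.

References (TYPES/STRUCTURE only): [Balaban1987RG1] CMP 109 (1987) (0.20) p. 256, (0.28) p. 258, (1.3) p. 260, (1.17)–(1.18)
p. 263, (1.20)–(1.22) p. 264, (4.3)–(4.5) pp. 281–282; [Balaban1988RG2Cluster] CMP 116 (1988) (1.36) p. 9, Lemma 3 (2.38) p. 20.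
-/

noncomputable section

namespace Summit.QuantumFields.BalabanUV.T4Continuum.NE4ReadOutSocketMarginalFree

open scoped BigOperators
open Literature.MathematicalPhysics.QuantumFieldTheory.Balaban1983to89
open FlowStep (HBeta RGEqH Box)
open T4OutputRate (Carriers Functional NE5)
open T4CouplingMatching (disc ScaleShiftRate HistLipschitz)
open T4CauchySum (InjectedRate)
open T4BetaReadOut (Slice ReadOut RepresentsA RepresentsB)
open T4BetaReadOutLipschitz (Probes)
open T4FlagMemory (extd)
open T4HistoryLipschitzRecursion (prodModuli restrictScale ScaleZeroFree AdmissibleTerms AdmRestrict ChannelAdditive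
  ChannelStepSum ChannelSizeAtStepNN)
open T4HistoryLipschitzOuter (Factorises)
open T4HistoryLipschitzActivity (ClusterGeom)
open T4HistoryLipschitzSegment (TwoPointKP sizeRadius)
open NE9MarginalProjection (compProj margProj shiftRead DirSize)
open NE9MarginalFreeClass (projInto_recipe)
open NE9FadingArithmeticRider (one_le_readConst_mul_dirSize)
open NE4ReadOutSocketMarginal (fadingMemory_const_nonneg)
open NE4ReadOutSocketMarginalRecipe (ne4_of_margNE9_NE5_recipe readSize_recipe recipe_restrictScale
  restrictScale_mem_analytic)

variable {C : Carriers}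

/-! ## §0 Class bookkeeping: the channel binders are antitone in the class -/

section ClassBookkeeping

variable {Bg ι : Type} {M M' : Set (Bg → C.Dom → ℝ)} {T : ℕ → (ℕ → ℝ) → (Bg → C.Dom → ℝ) → ι → ℝ}

/-- `ChannelAdditive` restricts to a smaller class. [folklore] -/
theorem channelAdditive_anti (h : M ⊆ M') (hT : ChannelAdditive M' T) : ChannelAdditive M T :=
  fun k s H₁ h₁ H₂ h₂ y => hT k s H₁ (h h₁) H₂ (h h₂) y

/-- `ChannelStepSum` restricts to a smaller class. [folklore] -/
theorem channelStepSum_anti (h : M ⊆ M') (hT : ChannelStepSum M' T) : ChannelStepSum M T :=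
  fun k s H hH y => hT k s H (h hH) y

/-- `ChannelSizeAtStepNN` restricts to a smaller class (same weights, same per-step profile). [folklore] -/
theorem channelSizeAtStepNN_anti {κ : ℝ} {wt : ℕ → ι → ℝ} {τ : ℕ → ℕ → ℝ} (h : M ⊆ M')
    (hT : ChannelSizeAtStepNN M' T κ wt τ) : ChannelSizeAtStepNN M T κ wt τ :=
  fun k j hjk s H hH hsupp N hN hbd y => hT k j hjk s H (h hH) hsupp N hN hbd y

end ClassBookkeeping

/-! ## §1 The normalisation floor at node U2 and the necessary memory gap -/

section Floor

variable {Bg : Type} {V : Type*} [NormedAddCommGroup V] [NormedSpace ℂ V] {ιp : Type*}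

/-- **THE NORMALISATION FLOOR FOR PROBE RECIPES.**  If node U2's probe recipe (chart radius `α > 0`, locality sum `K`,
non-empty probe sets; read-out constant `cr = 8K/α²`, `readSize_recipe`) is NORMALISED at one step `k` against an
analytic marginal direction `A` of size `aA` in the `e^{−κd}` currency (`DirSize`), then `1 ≤ (8K/α²)·aA` — row NE9's
(w10) floor `one_le_readConst_mul_dirSize` on the analytic class, BY NAME.  Bookkeeping on displayed binders; the
locators are TYPES only. [cite: Balaban1987RG1, (1.17)-(1.18) p.263 and (1.20)-(1.22) p.264] -/
theorem one_le_readConst_mul_dirSize_recipe (Pr : Probes C Bg V ιp) {α κ K aA : ℝ} (hα : 0 < α)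
    (hK : Pr.LocalitySum κ K) (hne : ∀ k, (Pr.idx k).Nonempty) {A : Slice C Bg} (hAan : A ∈ Pr.Analytic α)
    (hDir : DirSize A κ aA) (haA : 0 ≤ aA) {k : ℕ} (hnorm : Pr.recipe k A = 1) : 1 ≤ 8 * K / α ^ 2 * aA :=
  one_le_readConst_mul_dirSize (readSize_recipe Pr hα hK hne fun _ h => h) hDir haA
    (restrictScale_mem_analytic Pr hAan (k + 1))
    (by simp only [shiftRead, Nat.succ_ne_zero, if_false, Nat.succ_sub_one, recipe_restrictScale, hnorm])

/-- **THE MEMORY-RATE FLOOR** (scalar).  Under the floor `1 ≤ cr·aA` the memory rate of the marginal face is at least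
the projection-free rate with the feedback gain DOUBLED: `ω + 16·lipbar·B·τ̄ ≤ ω + 8·lipbar·B·((1 + cr·aA)·τ̄)`.
[folklore] -/
theorem memoryRate_floor {ω lipbar B cr aA τbar : ℝ} (hlip : 0 ≤ lipbar) (hB : 0 ≤ B) (hτ : 0 ≤ τbar)
    (hc : 1 ≤ cr * aA) : ω + 16 * lipbar * B * τbar ≤ ω + 8 * lipbar * B * ((1 + cr * aA) * τbar) := by
  have h0 : 0 ≤ lipbar * B * τbar := mul_nonneg (mul_nonneg hlip hB) hτ
  nlinarith [mul_nonneg h0 (sub_nonneg.mpr hc)]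

/-- **THE MEMORY GAP IS A NODE-U2-FREE SMALLNESS (necessary form).**  If the discrete-Grönwall gap of
`T4CurrencyMatching.injectedRate_of_runs_gap` holds in the marginal letters, `ω + 8·lipbar·B·((1 + cr·aA)·τ̄) < ρ`, and the
read-out is normalised (`1 ≤ cr·aA`), then `ω + 16·lipbar·B·τ̄ < ρ`. [folklore] -/
theorem memoryGap_necessary {ω ρ lipbar B cr aA τbar : ℝ} (hlip : 0 ≤ lipbar) (hB : 0 ≤ B) (hτ : 0 ≤ τbar)
    (hc : 1 ≤ cr * aA) (hgap : ω + 8 * lipbar * B * ((1 + cr * aA) * τbar) < ρ) :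
    ω + 16 * lipbar * B * τbar < ρ :=
  (memoryRate_floor hlip hB hτ hc).trans_lt hgap

/-- The memory-rate floor for a normalised probe recipe: `ω + 16·lipbar·B·τ̄ ≤ ω + 8·lipbar·B·((1 + (8K/α²)·aA)·τ̄)`.
[cite: Balaban1987RG1, (1.18) p.263 and (1.20)-(1.22) p.264] -/
theorem memoryRate_floor_recipe (Pr : Probes C Bg V ιp) {α κ K aA ω lipbar B τbar : ℝ} (hα : 0 < α)
    (hK : Pr.LocalitySum κ K) (hne : ∀ k, (Pr.idx k).Nonempty) {A : Slice C Bg} (hAan : A ∈ Pr.Analytic α)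
    (hDir : DirSize A κ aA) (haA : 0 ≤ aA) {k : ℕ} (hnorm : Pr.recipe k A = 1) (hlip : 0 ≤ lipbar) (hB : 0 ≤ B)
    (hτ : 0 ≤ τbar) : ω + 16 * lipbar * B * τbar ≤ ω + 8 * lipbar * B * ((1 + 8 * K / α ^ 2 * aA) * τbar) :=
  memoryRate_floor hlip hB hτ (one_le_readConst_mul_dirSize_recipe Pr hα hK hne hAan hDir haA hnorm)

/-- **NECESSARY SMALLNESS OF THE GAP FOR A NORMALISED PROBE RECIPE**: `ω + 8·lipbar·B·((1 + (8K/α²)·aA)·τ̄) < ρ` forces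
`ω + 16·lipbar·B·τ̄ < ρ` — node U2's constants `K`, `α` and the direction size `aA` eliminated.
[cite: Balaban1987RG1, (1.18) p.263 and (1.20)-(1.22) p.264] -/
theorem memoryGap_necessary_recipe (Pr : Probes C Bg V ιp) {α κ K aA ω ρ lipbar B τbar : ℝ} (hα : 0 < α)
    (hK : Pr.LocalitySum κ K) (hne : ∀ k, (Pr.idx k).Nonempty) {A : Slice C Bg} (hAan : A ∈ Pr.Analytic α)
    (hDir : DirSize A κ aA) (haA : 0 ≤ aA) {k : ℕ} (hnorm : Pr.recipe k A = 1) (hlip : 0 ≤ lipbar) (hB : 0 ≤ B)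
    (hτ : 0 ≤ τbar) (hgap : ω + 8 * lipbar * B * ((1 + 8 * K / α ^ 2 * aA) * τbar) < ρ) :
    ω + 16 * lipbar * B * τbar < ρ :=
  memoryGap_necessary hlip hB hτ (one_le_readConst_mul_dirSize_recipe Pr hα hK hne hAan hDir haA hnorm) hgap

end Floor

/-! ## §2 Node U2's triple on the marginal-projection END: no read-out binder, no projection binder -/

section FreeFace

variable {V : Type*} [NormedAddCommGroup V] [NormedSpace ℂ V] {ιp : Type*}

/-- **ROW NE4 — NODE U2's TRIPLE ON ROW NE9's MARGINAL-PROJECTION END, READ BY A NORMALISED PROBE RECIPE: NO READ-OUT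
BINDER AND NO PROJECTION BINDER LEFT.**  Generation 35's `NE4ReadOutSocketMarginalRecipe.ne4_of_margNE9_NE5_recipe` with
`hPinto` := `NE9MarginalFreeClass.projInto_recipe PB.transportTo hα hAdmA hAan hS hnorm` at the marginal-free class
`MF := {H | H ∈ PB.transportTo.Analytic α ∧ H ∈ S ∧ ∀ k, PB.transportTo.recipe k H = 0}` (INLINE; the channel binders
`hadd`/`hsum`/`hstep` are stated on it — restrict larger-class binders with §0).  Displayed instead of `hPinto`: `hAan`
(the marginal direction has analytic charts at the run-A probes — TYPE (1.17) p. 263), `hS` (the projections lie in the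
structural class `S` — O1 data), `hnorm` (every step's recipe reads 1 on `A` — [I] p. 258 / (1.20)–(1.22) p. 264, TYPE).
Everything else verbatim: row NE9's END binders, row NE5 BY SHAPE `hNE5f`, the representation `hA`/`hB`, the printed-type
analyticity `hAdmA`/`h𝒜B`, `hα`, `hK`, `hne`.  Constants `cr = 8K/α²`, `ℓ = 8·clipbar·B + 8·lipbar·B·qTbar`,
`ν = ω + 8·lipbar·B·((1 + (8K/α²)·aA)·τ̄)`.  Nothing of [I] is asserted.
[cite: Balaban1987RG1, (0.28) p.258, (1.3) p.260, (1.17)-(1.18) p.263, (1.20)-(1.22) p.264 and (4.3)-(4.5) pp.281-282] -/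
theorem ne4_of_margNE9_NE5_recipe_free (G : ClusterGeom C) {Pot : Type*} [NormedAddCommGroup Pot] [NormedSpace ℂ Pot]
    (PB : Probes C C.BgB V ιp) {ιc : Type} {EA : Functional C C.BgA} {W : Set (ℕ → ℝ)} {Adm : Set (C.BgA → C.Dom → ℝ)}
    {S : Set (Slice C C.BgA)} {A : C.BgA → C.Dom → ℝ} {𝒯 : ℕ → (ℕ → ℝ) → (C.BgA → C.Dom → ℝ) → ιc → ℝ}
    {Ψ : ℕ → ℝ → (ιc → ℝ) → C.BgA → C.Dom → ℝ} {act : ℕ → ℝ → C.BgA → Pot → G.P → ℂ} {𝒜 : ℕ → Set Pot}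
    {n : ℕ → ℝ → C.BgA → G.P → ℝ} {lip clip : ℕ → ℝ} {aP dP : G.P → ℝ} {δ : C.Dom → ℝ}
    {κ B lipbar clipbar qTbar τbar ω aA ℓ ν α K : ℝ} {wt : ℕ → ιc → ℝ} {τ : ℕ → ℕ → ℝ} {qT p₀ N : ℕ → ℝ}
    (ρT : ℕ → (ιc → ℝ) → Pot) (U₀ : C.BgA) (explZ : ℕ → C.BgA → C.Dom → ℝ) {β : HBeta} {γ : ℝ}
    -- ===== row NE9's marginal-projection END at `P := margProj (shiftRead PB.transportTo.recipe) A`, cr = 8K/α²;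
    --       channel binders ON the inline marginal-free class; NO projection binder =====
    (h0 : ScaleZeroFree EA W) (hAdm : AdmissibleTerms EA W Adm) (hres : AdmRestrict Adm)
    (hDir : DirSize A κ aA) (haA : 0 ≤ aA)
    (hadd : ChannelAdditive
      {H | H ∈ PB.transportTo.Analytic α ∧ H ∈ S ∧ ∀ k, PB.transportTo.recipe k H = 0} 𝒯)
    (hsum : ChannelStepSum
      {H | H ∈ PB.transportTo.Analytic α ∧ H ∈ S ∧ ∀ k, PB.transportTo.recipe k H = 0} 𝒯)
    (hstep : ChannelSizeAtStepNN
      {H | H ∈ PB.transportTo.Analytic α ∧ H ∈ S ∧ ∀ k, PB.transportTo.recipe k H = 0} 𝒯 κ wt τ)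
    (hfac : Factorises EA W (compProj 𝒯 (margProj (shiftRead PB.transportTo.recipe) A)) Ψ) (hclip0 : ∀ k, 0 ≤ clip k)
    (hCup : ∀ g ∈ W, ∀ g' ∈ W, ∀ (k : ℕ) (U : C.BgA) (X : C.Dom), C.scale X = k + 1 → ∀ Q ∈ 𝒜 k, ∀ γ' ∈ G.vol X,
      ‖act k (g k) U Q γ'‖ ≤ n k (g' k) U γ' ∧
        ‖act k (g k) U Q γ' - act k (g' k) U Q γ'‖ ≤ clip k * |g k - g' k| * n k (g' k) U γ')
    (hqT0 : ∀ k, 0 ≤ qT k)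
    (hTcup : ∀ g ∈ W, ∀ g' ∈ W, ∀ (k : ℕ) (y : ιc),
      |compProj 𝒯 (margProj (shiftRead PB.transportTo.recipe) A) k g (EA g) y -
          compProj 𝒯 (margProj (shiftRead PB.transportTo.recipe) A) k g' (EA g) y| ≤ wt k y * (qT k * |g k - g' k|))
    (hreprV : ∀ (k : ℕ) (s : ℝ) (Q : ιc → ℝ) (U : C.BgA) (X : C.Dom),
      Ψ k s Q U X = (G.newTerm act k s U X (ρT k Q)).re - (G.newTerm act k s U₀ X (ρT k Q)).re + explZ k U X)
    (hclipb : ∀ k, clip k ≤ clipbar) (hqTb : ∀ k, qT k ≤ qTbar)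
    (hKP : TwoPointKP G W act 𝒜 n lip aP dP) (hdec : G.DecayExtract δ dP) (hpinB : G.PinBudget aP δ (fun _ => B) κ)
    (hρT : ∀ (k : ℕ) (Q Q' : ιc → ℝ) (M : ℝ), (∀ y, |Q y - Q' y| ≤ wt k y * M) → ‖ρT k Q - ρT k Q'‖ ≤ M)
    (hexplZ : ∀ (k : ℕ) (U : C.BgA) (X : C.Dom), C.scale X = k + 1 → |explZ k U X| ≤ Real.exp (-(κ * C.d X)) * p₀ k)
    (hbase : ∀ g ∈ W, ∀ (U : C.BgA) (X : C.Dom), C.scale X = 0 → |EA g U X| ≤ Real.exp (-(κ * C.d X)) * N 0)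
    (hNsucc : ∀ j, p₀ j + 2 * B ≤ N (j + 1)) (hNnn : ∀ j, 0 ≤ N j)
    (hbox : ∀ (k : ℕ) (Q : ιc → ℝ),
      (∀ y, |Q y| ≤ wt k y * sizeRadius (fun k j => (1 + 8 * K / α ^ 2 * aA) * τ k j) N k) → ρT k Q ∈ 𝒜 k)
    (hB0 : 0 ≤ B) (hlipb : ∀ k, lip k ≤ lipbar) (hτbar : 0 ≤ τbar) (hω : 0 ≤ ω)
    (hpos : 0 < ω + 8 * lipbar * B * ((1 + 8 * K / α ^ 2 * aA) * τbar))
    (hτ : ∀ k j, j ≤ k → 0 ≤ τ k j ∧ τ k j ≤ τbar * ω ^ (k - j))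
    (hℓ : 8 * clipbar * B + 8 * lipbar * B * qTbar = ℓ) (hν : ω + 8 * lipbar * B * ((1 + 8 * K / α ^ 2 * aA) * τbar) = ν)
    -- ===== row NE5 BY SHAPE =====
    {EBfam : ℝ → Functional C C.BgB} {θ₅ C₅ : ℝ} (hNE5f : ∀ b', 0 < b' → b' ≤ γ → NE5 EA (EBfam b') W κ θ₅ C₅)
    -- ===== node U2: the probe recipe's data; representation and printed-type analyticity =====
    (hW : ∀ k (v : Fin (k + 1) → ℝ), v ∈ Box γ k → extd v ∈ W)
    (hA : RepresentsA EA PB.transportTo.recipe γ β) (hB : RepresentsB EBfam PB.recipe γ β)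
    (hAdmA : Adm ⊆ PB.transportTo.Analytic α) (h𝒜B : ∀ b', 0 < b' → b' ≤ γ → ∀ g' ∈ W, EBfam b' g' ∈ PB.Analytic α)
    (hα : 0 < α) (hK : PB.LocalitySum κ K) (hne : ∀ k, (PB.idx k).Nonempty)
    -- ===== NEW at generation 36, in place of `hPinto`: the marginal direction and its normalisation =====
    (hAan : A ∈ PB.transportTo.Analytic α)
    (hS : ∀ H ∈ Adm, margProj (shiftRead PB.transportTo.recipe) A H ∈ S)
    (hnorm : ∀ k, PB.transportTo.recipe k A = 1) :
    ScaleShiftRate (8 * K / α ^ 2 * C₅ * θ₅) θ₅ γ β ∧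
      HistLipschitz (fun k i => 8 * K / α ^ 2 * prodModuli ℓ (fun _ => ν) (k + 1) i) γ β ∧
        T4CouplingMatching.FadingMemory (8 * K / α ^ 2 * (ℓ / ν) * ν) ν
          (fun k i => 8 * K / α ^ 2 * prodModuli ℓ (fun _ => ν) (k + 1) i) :=
  ne4_of_margNE9_NE5_recipe G PB ρT U₀ explZ h0 hAdm hres hDir haA
    (projInto_recipe PB.transportTo hα hAdmA hAan hS hnorm) hadd hsum hstep hfac hclip0 hCup hqT0 hTcup hreprV hclipb
    hqTb hKP hdec hpinB hρT hexplZ hbase hNsucc hNnn hbox hB0 hlipb hτbar hω hpos hτ hℓ hν hNE5f hW hA hB hAdmA h𝒜B hα hK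
    hne

/-! ## §3 Node U2's output in the spine's currency (gap route), and what its gap forces -/

/-- **ROW NE4 — NODE U2's OUTPUT `InjectedRate` ON ROW NE9's MARGINAL-PROJECTION END, NORMALISED PROBE RECIPE.**  §2's
binders plus node U1/H3's runs of (0.20) with history (`hrun`), the printed box (`hgbox`), the infrared pin (`hpin`), the
signs `0 ≤ θ₅`, `0 ≤ C₅`, the rates `θ₅ ≤ ρ`, `0 < ρ < 1`, the MEMORY GAP `hνρ : ν < ρ` and the window `hsmall` (g-currency,
weight `γ³/2`); conclusion = `T4CurrencyMatching.injectedRate_of_runs_gap` on §2's triple — the binder `hinj` of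
`T4TowerRateDischarge.uRateUpTo_of_nodes`.  NO `EventualLowerH` (no asymptotic-freedom input).  By §1 the displayed gap
forces `ω + 16·lipbar·B·τ̄ < ρ` (`memoryGap_necessary_of_face`). [cite: Balaban1987RG1, (0.20) p.256, (1.3) p.260, (1.17)-(1.18) p.263 and (1.20)-(1.22) p.264] -/
theorem injectedRate_of_margNE9_NE5_recipe_free (G : ClusterGeom C) {Pot : Type*} [NormedAddCommGroup Pot]
    [NormedSpace ℂ Pot] (PB : Probes C C.BgB V ιp) {ιc : Type} {EA : Functional C C.BgA} {W : Set (ℕ → ℝ)}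
    {Adm : Set (C.BgA → C.Dom → ℝ)} {S : Set (Slice C C.BgA)} {A : C.BgA → C.Dom → ℝ}
    {𝒯 : ℕ → (ℕ → ℝ) → (C.BgA → C.Dom → ℝ) → ιc → ℝ}
    {Ψ : ℕ → ℝ → (ιc → ℝ) → C.BgA → C.Dom → ℝ} {act : ℕ → ℝ → C.BgA → Pot → G.P → ℂ} {𝒜 : ℕ → Set Pot}
    {n : ℕ → ℝ → C.BgA → G.P → ℝ} {lip clip : ℕ → ℝ} {aP dP : G.P → ℝ} {δ : C.Dom → ℝ}
    {κ B lipbar clipbar qTbar τbar ω aA ℓ ν α K : ℝ} {wt : ℕ → ιc → ℝ} {τ : ℕ → ℕ → ℝ} {qT p₀ N : ℕ → ℝ}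
    (ρT : ℕ → (ιc → ℝ) → Pot) (U₀ : C.BgA) (explZ : ℕ → C.BgA → C.Dom → ℝ) {β : HBeta} {γ : ℝ}
    (h0 : ScaleZeroFree EA W) (hAdm : AdmissibleTerms EA W Adm) (hres : AdmRestrict Adm)
    (hDir : DirSize A κ aA) (haA : 0 ≤ aA)
    (hadd : ChannelAdditive
      {H | H ∈ PB.transportTo.Analytic α ∧ H ∈ S ∧ ∀ k, PB.transportTo.recipe k H = 0} 𝒯)
    (hsum : ChannelStepSum
      {H | H ∈ PB.transportTo.Analytic α ∧ H ∈ S ∧ ∀ k, PB.transportTo.recipe k H = 0} 𝒯)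
    (hstep : ChannelSizeAtStepNN
      {H | H ∈ PB.transportTo.Analytic α ∧ H ∈ S ∧ ∀ k, PB.transportTo.recipe k H = 0} 𝒯 κ wt τ)
    (hfac : Factorises EA W (compProj 𝒯 (margProj (shiftRead PB.transportTo.recipe) A)) Ψ) (hclip0 : ∀ k, 0 ≤ clip k)
    (hCup : ∀ g ∈ W, ∀ g' ∈ W, ∀ (k : ℕ) (U : C.BgA) (X : C.Dom), C.scale X = k + 1 → ∀ Q ∈ 𝒜 k, ∀ γ' ∈ G.vol X,
      ‖act k (g k) U Q γ'‖ ≤ n k (g' k) U γ' ∧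
        ‖act k (g k) U Q γ' - act k (g' k) U Q γ'‖ ≤ clip k * |g k - g' k| * n k (g' k) U γ')
    (hqT0 : ∀ k, 0 ≤ qT k)
    (hTcup : ∀ g ∈ W, ∀ g' ∈ W, ∀ (k : ℕ) (y : ιc),
      |compProj 𝒯 (margProj (shiftRead PB.transportTo.recipe) A) k g (EA g) y -
          compProj 𝒯 (margProj (shiftRead PB.transportTo.recipe) A) k g' (EA g) y| ≤ wt k y * (qT k * |g k - g' k|))
    (hreprV : ∀ (k : ℕ) (s : ℝ) (Q : ιc → ℝ) (U : C.BgA) (X : C.Dom),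
      Ψ k s Q U X = (G.newTerm act k s U X (ρT k Q)).re - (G.newTerm act k s U₀ X (ρT k Q)).re + explZ k U X)
    (hclipb : ∀ k, clip k ≤ clipbar) (hqTb : ∀ k, qT k ≤ qTbar)
    (hKP : TwoPointKP G W act 𝒜 n lip aP dP) (hdec : G.DecayExtract δ dP) (hpinB : G.PinBudget aP δ (fun _ => B) κ)
    (hρT : ∀ (k : ℕ) (Q Q' : ιc → ℝ) (M : ℝ), (∀ y, |Q y - Q' y| ≤ wt k y * M) → ‖ρT k Q - ρT k Q'‖ ≤ M)
    (hexplZ : ∀ (k : ℕ) (U : C.BgA) (X : C.Dom), C.scale X = k + 1 → |explZ k U X| ≤ Real.exp (-(κ * C.d X)) * p₀ k)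
    (hbase : ∀ g ∈ W, ∀ (U : C.BgA) (X : C.Dom), C.scale X = 0 → |EA g U X| ≤ Real.exp (-(κ * C.d X)) * N 0)
    (hNsucc : ∀ j, p₀ j + 2 * B ≤ N (j + 1)) (hNnn : ∀ j, 0 ≤ N j)
    (hbox : ∀ (k : ℕ) (Q : ιc → ℝ),
      (∀ y, |Q y| ≤ wt k y * sizeRadius (fun k j => (1 + 8 * K / α ^ 2 * aA) * τ k j) N k) → ρT k Q ∈ 𝒜 k)
    (hB0 : 0 ≤ B) (hlipb : ∀ k, lip k ≤ lipbar) (hτbar : 0 ≤ τbar) (hω : 0 ≤ ω)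
    (hpos : 0 < ω + 8 * lipbar * B * ((1 + 8 * K / α ^ 2 * aA) * τbar))
    (hτ : ∀ k j, j ≤ k → 0 ≤ τ k j ∧ τ k j ≤ τbar * ω ^ (k - j))
    (hℓ : 8 * clipbar * B + 8 * lipbar * B * qTbar = ℓ) (hν : ω + 8 * lipbar * B * ((1 + 8 * K / α ^ 2 * aA) * τbar) = ν)
    {EBfam : ℝ → Functional C C.BgB} {θ₅ C₅ : ℝ} (hNE5f : ∀ b', 0 < b' → b' ≤ γ → NE5 EA (EBfam b') W κ θ₅ C₅)
    (hθ₅0 : 0 ≤ θ₅) (hC₅ : 0 ≤ C₅)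
    (hW : ∀ k (v : Fin (k + 1) → ℝ), v ∈ Box γ k → extd v ∈ W)
    (hA : RepresentsA EA PB.transportTo.recipe γ β) (hB : RepresentsB EBfam PB.recipe γ β)
    (hAdmA : Adm ⊆ PB.transportTo.Analytic α) (h𝒜B : ∀ b', 0 < b' → b' ≤ γ → ∀ g' ∈ W, EBfam b' g' ∈ PB.Analytic α)
    (hα : 0 < α) (hK : PB.LocalitySum κ K) (hne : ∀ k, (PB.idx k).Nonempty)
    (hAan : A ∈ PB.transportTo.Analytic α)
    (hS : ∀ H ∈ Adm, margProj (shiftRead PB.transportTo.recipe) A H ∈ S)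
    (hnorm : ∀ k, PB.transportTo.recipe k A = 1)
    -- ===== node U1/H3's runs, the rates, the memory gap and the window =====
    {ρ : ℝ} (g : ℕ → ℕ → ℝ) (gIR : ℝ) (hθ₅ρ : θ₅ ≤ ρ) (hνρ : ν < ρ) (hρ0 : 0 < ρ) (hρ1 : ρ < 1) (hγ : 0 ≤ γ)
    (hrun : ∀ K', RGEqH K' β (g K')) (hgbox : ∀ K' i, i ≤ K' → 0 < g K' i ∧ g K' i ≤ γ) (hpin : ∀ K', g K' K' = gIR)
    (hsmall : 8 * K / α ^ 2 * (ℓ / ν) * ν * (γ ^ 3 / 2) * (ρ / (ρ - ν)) ≤ (1 - ρ) / 2) :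
    InjectedRate (2 * (8 * K / α ^ 2 * C₅ * θ₅) / (1 - ρ)) 0 ρ (fun K' j => disc (g K') (g (K' + 1)) j) := by
  obtain ⟨hSR, hL, hM⟩ := ne4_of_margNE9_NE5_recipe_free G PB ρT U₀ explZ h0 hAdm hres hDir haA hadd hsum hstep hfac
    hclip0 hCup hqT0 hTcup hreprV hclipb hqTb hKP hdec hpinB hρT hexplZ hbase hNsucc hNnn hbox hB0 hlipb hτbar hω hpos hτ hℓ
    hν hNE5f hW hA hB hAdmA h𝒜B hα hK hne hAan hS hnorm
  have hν0 : 0 ≤ ν := by rw [← hν]; exact hpos.le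
  have hcr : 0 ≤ 8 * K / α ^ 2 := div_nonneg (mul_nonneg (by norm_num) (PB.localitySum_nonneg hK)) (sq_nonneg α)
  exact T4CurrencyMatching.injectedRate_of_runs_gap g gIR hρ0 hρ1 hθ₅0 hθ₅ρ hν0 hνρ
    (mul_nonneg (mul_nonneg hcr hC₅) hθ₅0) (fadingMemory_const_nonneg hM) hγ hrun hgbox hpin hSR hL hM hsmall

/-- **WHAT THE DISPLAYED GAP OF §3 FORCES.**  On the face's own letters: the memory gap `hνρ : ν < ρ` with
`ν = ω + 8·lipbar·B·((1 + (8K/α²)·aA)·τ̄)`, the normalisation `hnorm`, the direction binders `hDir`/`haA`/`hAan` and the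
recipe data `hα`/`hK`/`hne` give `ω + 16·lipbar·B·τ̄ < ρ` as soon as `0 ≤ lipbar` (e.g. from `0 ≤ lip 0 ≤ lipbar`): the
smallness a consumer of §3 must meet BEFORE node U2's constants are even looked at. [cite: Balaban1987RG1, (1.18) p.263 and (1.20)-(1.22) p.264] -/
theorem memoryGap_necessary_of_face (PB : Probes C C.BgB V ιp) {α κ K aA ω ρ ν lipbar B τbar : ℝ}
    {A : C.BgA → C.Dom → ℝ} (hDir : DirSize A κ aA) (haA : 0 ≤ aA) (hB0 : 0 ≤ B) (hτbar : 0 ≤ τbar)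
    (hν : ω + 8 * lipbar * B * ((1 + 8 * K / α ^ 2 * aA) * τbar) = ν) (hα : 0 < α) (hK : PB.LocalitySum κ K)
    (hne : ∀ k, (PB.idx k).Nonempty) (hAan : A ∈ PB.transportTo.Analytic α) (hnorm : ∀ k, PB.transportTo.recipe k A = 1)
    (hlip : 0 ≤ lipbar) (hνρ : ν < ρ) : ω + 16 * lipbar * B * τbar < ρ :=
  memoryGap_necessary_recipe PB.transportTo hα hK hne hAan hDir haA (hnorm 0) hlip hB0 hτbar (hν.trans_lt hνρ)

end FreeFace

/-! ## §4 (v1.1) Non-vacuity of the scalar list with the floor at equality -/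

/-- **THE L5 SCALARS OF §3 ARE JOINTLY SATISFIABLE WITH THE §1 FLOOR AT EQUALITY** (decided toy numbers; witnesses,
never statement inputs): `ω = 1/4`, `ρ = θ₅ = 1/2`, `lipbar = B = 1`, `τ̄ = 1/128`, `K = 1`, `α = 2`, `aA = 1/2` (so
`cr = 8K/α² = 2`, `cr·aA = 1`), `ℓ = 1/64`, `γ = 1/2`, memory rate `ν = 3/8`: floor, `hpos`, gap `ν < ρ`, `θ₅ ≤ ρ < 1`,
window `hsmall`, the necessary line `ω + 16·lipbar·B·τ̄ < ρ` and the sufficient line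
`8·lipbar·B·((1 + cr·aA)·τ̄) ≤ (ρ − ω)/2` of `NE4ReadOutSocketMarginal.memoryGap_of_smallness` all hold. [folklore] -/
example :
    let ω : ℝ := 1 / 4; let ρ : ℝ := 1 / 2; let θ₅ : ℝ := 1 / 2; let lipbar : ℝ := 1; let B : ℝ := 1
    let τbar : ℝ := 1 / 128; let K : ℝ := 1; let α : ℝ := 2; let aA : ℝ := 1 / 2; let ℓ : ℝ := 1 / 64; let γ : ℝ := 1 / 2
    let ν : ℝ := ω + 8 * lipbar * B * ((1 + 8 * K / α ^ 2 * aA) * τbar)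
    8 * K / α ^ 2 * aA = 1 ∧ 0 < ω + 8 * lipbar * B * ((1 + 8 * K / α ^ 2 * aA) * τbar) ∧ ν = 3 / 8 ∧ ν < ρ ∧
      θ₅ ≤ ρ ∧ 0 < ρ ∧ ρ < 1 ∧ 0 ≤ γ ∧ 8 * K / α ^ 2 * (ℓ / ν) * ν * (γ ^ 3 / 2) * (ρ / (ρ - ν)) ≤ (1 - ρ) / 2 ∧
      ω + 16 * lipbar * B * τbar < ρ ∧ 8 * lipbar * B * ((1 + 8 * K / α ^ 2 * aA) * τbar) ≤ (ρ - ω) / 2 := by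
  simp only
  norm_num

/-- **THE FACTOR 2 BITES**: with the same `ω = 1/4 < ρ = 1/2`, `lipbar = B = 1` but `τ̄ = 1/60`, the necessary line of §1
FAILS (`1/4 + 16/60 = 31/60 > 1/2`) although the projection-free gain `8·τ̄ = 2/15 < ρ − ω = 1/4` would pass. [folklore] -/
example : ¬ ((1 : ℝ) / 4 + 16 * 1 * 1 * (1 / 60) < 1 / 2) ∧ (8 : ℝ) * 1 * 1 * (1 / 60) < 1 / 2 - 1 / 4 := by
  norm_num

end Summit.QuantumFields.BalabanUV.T4Continuum.NE4ReadOutSocketMarginalFree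

end
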